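import Mathlib.MeasureTheory.Integral.Bochner.Set
import Mathlib.MeasureTheory.Constructions.BorelSpace.Basic
import Mathlib.Topology.Algebra.OpenSubgroup
import HarnessLib

/-!
# Integrals of coset-invariant functions over a compact group are finite coset sums

Topic `NumberTheory/Automorphic`; namespace `Literature.NumberTheory.Automorphic`. A small
measure-theoretic helper for the finite-place half of the Kirillov `L²`-bound on `GL_2` (the
`n ≤ 2` case of the named fact `JacquetShalika1981_partialPairL_pole_of_eq_conj`): if `G` is a
compact group, `H ≤ G` an open subgroup (so `G/H` is finite, Mathlib
`Subgroup.quotient_finite_of_isOpen`) and `F : G → E` is integrable and right `H`-invariant, then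

  `∫_G F dμ = ∑_{q ∈ G/H} μ(q H) • F(q)`   (`integral_eq_sum_quotient_of_mul_invariant`)

for every finite measure `μ` — the fibres of `G → G/H` are open, pairwise disjoint, cover `G`, and
`F` is constant on each. This is how twisted averages over a compact open subgroup of a `p`-adic
group become finite sums on vectors of fixed level (Bump (1997), §4.4 / §3.1: the Hecke algebra of
locally constant functions). Proof complete; no named facts.

## References

* D. Bump, *Automorphic Forms and Representations*, CUP (1997), §3.1, §4.4 [Bump1997].
-/

noncomputable section

open MeasureTheory Set

namespace Literature.NumberTheory.Automorphic

variable {G : Type*} [Group G] [TopologicalSpace G] [IsTopologicalGroup G]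
  [MeasurableSpace G] [BorelSpace G]

omit [MeasurableSpace G] [BorelSpace G] in
/-- The fibre of `G → G/H` over `q` is open for `H` open. [folklore] -/
theorem isOpen_preimage_mk_singleton (H : Subgroup G) (hH : IsOpen (H : Set G)) (q : G ⧸ H) :
    IsOpen ((QuotientGroup.mk : G → G ⧸ H) ⁻¹' {q}) := by
  haveI : DiscreteTopology (G ⧸ H) := QuotientGroup.discreteTopology hH
  exact (isOpen_discrete _).preimage QuotientGroup.continuous_mk

omit [TopologicalSpace G] [IsTopologicalGroup G] [MeasurableSpace G] [BorelSpace G] in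
/-- A right `H`-invariant function is constant on the fibres of `G → G/H`. [folklore] -/
theorem apply_eq_apply_out_of_mul_invariant (H : Subgroup G) {E : Type*} {F : G → E}
    (hF : ∀ g, ∀ h ∈ H, F (g * h) = F g) {q : G ⧸ H} {g : G} (hg : (QuotientGroup.mk g : G ⧸ H) = q) :
    F g = F q.out := by
  have h1 : (QuotientGroup.mk q.out : G ⧸ H) = QuotientGroup.mk g := by rw [QuotientGroup.out_eq', hg]
  have h2 : q.out⁻¹ * g ∈ H := QuotientGroup.eq.1 h1
  have h3 : g = q.out * (q.out⁻¹ * g) := by group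
  rw [h3, hF _ _ h2]

/-- **Integrals of right `H`-invariant functions are finite coset sums**:
`∫_G F dμ = ∑_{q ∈ G/H} μ(qH) • F(q)` for `H` open in the compact group `G`, `F` integrable and
right `H`-invariant, `μ` any finite measure. [cite: Bump1997, §4.4] -/
theorem integral_eq_sum_quotient_of_mul_invariant (μ : Measure G) (H : Subgroup G) (hH : IsOpen (H : Set G))
    [Fintype (G ⧸ H)] {E : Type*} [NormedAddCommGroup E] [NormedSpace ℝ E] [CompleteSpace E] {F : G → E}
    (hFi : Integrable F μ) (hF : ∀ g, ∀ h ∈ H, F (g * h) = F g) :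
    ∫ g, F g ∂μ = ∑ q : G ⧸ H, (μ ((QuotientGroup.mk : G → G ⧸ H) ⁻¹' {q})).toReal • F q.out := by
  set s : G ⧸ H → Set G := fun q => (QuotientGroup.mk : G → G ⧸ H) ⁻¹' {q} with hs
  have hsm : ∀ q, MeasurableSet (s q) := fun q => (isOpen_preimage_mk_singleton H hH q).measurableSet
  have hsd : Pairwise (Function.onFun Disjoint s) := fun q q' hne =>
    Set.disjoint_iff.2 fun g hg => hne ((hg.1 : QuotientGroup.mk g = q).symm.trans (hg.2 : QuotientGroup.mk g = q'))
  have hsU : (⋃ q, s q) = univ := by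
    ext g
    simp only [mem_iUnion, mem_univ, iff_true]
    exact ⟨QuotientGroup.mk g, rfl⟩
  calc ∫ g, F g ∂μ = ∫ g in ⋃ q, s q, F g ∂μ := by rw [hsU, setIntegral_univ]
    _ = ∑ q, ∫ g in s q, F g ∂μ := integral_iUnion_fintype hsm hsd fun q => hFi.integrableOn
    _ = ∑ q : G ⧸ H, (μ (s q)).toReal • F q.out := by
        refine Finset.sum_congr rfl fun q _ => ?_
        rw [setIntegral_congr_fun (hsm q) (fun g hg => apply_eq_apply_out_of_mul_invariant H hF hg), setIntegral_const]
        rfl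

/-- The masses of the fibres add up to the total mass. [folklore] -/
theorem sum_measureReal_preimage_mk (μ : Measure G) [IsFiniteMeasure μ] (H : Subgroup G) (hH : IsOpen (H : Set G)) [Fintype (G ⧸ H)] :
    ∑ q : G ⧸ H, (μ ((QuotientGroup.mk : G → G ⧸ H) ⁻¹' {q})).toReal = (μ univ).toReal := by
  have h := integral_eq_sum_quotient_of_mul_invariant μ H hH (F := fun _ : G => (1 : ℝ)) (integrable_const _) (fun _ _ _ => rfl)
  simp only [integral_const, smul_eq_mul, mul_one] at h
  rw [← h]
  rfl

end Literature.NumberTheory.Automorphic
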